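import Mathlib
import HarnessLib
import Literature.MathematicalPhysics.QuantumLattice.HubbardModelThermodynamicLimitProofs
import Literature.MathematicalPhysics.QuantumLattice.DWaveSourceProofs
import Literature.MathematicalPhysics.QuantumLattice.HubbardHighTemperatureTwoPoint

set_option linter.dupNamespace false

/-!
# Route `WeakCouplingBCS` — crux `WcbcsBcsConstruction` (stmt-HubbardSuperconductivity-2010),
# line `lro-seed-kink-bridge`, stub `stub_torusBoxComparison`

**Torus versus box.** On the common vertex set `FermionTorus 2 L = Lex (Fin 2 → Fin L)` the
grand-canonical ground energies of the Hubbard Hamiltonian `H(1,U) - μN` with periodic boundary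
conditions (`hubbardTorusWith 2 L 1 U μ`, graph `fermionTorusGraph 2 L`) and with free boundary
conditions (the box graph `(zdGraph 2).comap (x ↦ (i ↦ (xᵢ : ℤ)))`) differ by at most `8(L+1)`.

Proof (folklore, the boundary estimate of the thermodynamic limit, Ruelle 1969 §2):
* sector by sector, the cut lemma `ThermodynamicLimit.groundEnergyAt_le_add_of_cut` with an EMPTY
  second block (`Λ₂ = Fin 0`, whose vacuum has energy `0`) compares two graphs on the same vertex
  set: `E_G(N) ≤ E_{G₁}(N) + 2|t|k` if the adjacencies differ on `≤ k` ordered pairs;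
* box bonds are torus bonds, and a torus bond that is not a box bond wraps around a seam: the
  mismatched ordered pairs inject into the `4L` patterns `(L-1,m | 0,m)`, `(0,m | L-1,m)`,
  `(m,L-1 | m,0)`, `(m,0 | m,L-1)`, so `k ≤ 4L` and `|E_T(N) - E_B(N)| ≤ 8L` for every sector;
* the grand-canonical ground energy is the minimum over `N` of `E(N) - μN` (the hypothesis, stub
  `stub_gcGroundEnergyEqMin`), and finite minima of termwise `8L`-close families are `8L`-close.
-/

namespace Summit.HubbardSuperconductivity.HubbardSuperconductivity.Theorems

open Literature.MathematicalPhysics.QuantumLattice Literature.Probability.LatticeModels Matrix Filter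
open scoped Matrix.Norms.L2Operator ComplexOrder Topology

/-! ### The cut lemma with an empty second block -/

/-- On the empty lattice `Fin 0` the `0`-particle sector energy of the Hubbard Hamiltonian is `≤ 0`
(the vacuum is a normalised `0`-particle vector and `H = 0`). [folklore] -/
theorem groundEnergyAt_bot_fin_zero_le (t U : ℝ) :
    groundEnergyAt (⊥ : SimpleGraph (Fin 0)) t U 0 ≤ 0 := by
  have hH : hamiltonian (⊥ : SimpleGraph (Fin 0)) t U = 0 := by
    simp [hamiltonian]
  unfold groundEnergyAt
  have h := ThermodynamicLimit.groundEnergy_le_re_expect (hamiltonian (⊥ : SimpleGraph (Fin 0)) t U)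
    (N := 0) (ψ := Pi.single ∅ 1) ?_ ?_
  · simpa [hH, expect] using h
  · intro s hs
    rw [Pi.single_apply, if_neg]
    rintro rfl
    exact hs Finset.card_empty
  · rw [dotProduct_single, Pi.star_apply, Pi.single_eq_same, star_one, one_mul]

/-- **Cut lemma with an empty second block.** Two nearest-neighbour structures on the same finite,
linearly ordered vertex set whose adjacencies differ on at most `k` ordered pairs have Hubbard sector
energies within `2|t|k` of each other (`groundEnergyAt_le_add_of_cut` with `Λ₂ = Fin 0`). [folklore] -/
theorem groundEnergyAt_le_add_of_adj_mismatch {Λ : Type*} [LinearOrder Λ] [Fintype Λ]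
    (G G₁ : SimpleGraph Λ) [DecidableRel G.Adj] [DecidableRel G₁.Adj] {k : ℕ}
    (hk : Finset.card {p : Λ × Λ | ¬ (G.Adj p.1 p.2 ↔ G₁.Adj p.1 p.2)} ≤ k) (t U : ℝ) {N : ℕ}
    (hN : N ≤ 2 * Fintype.card Λ) :
    groundEnergyAt G t U N ≤ groundEnergyAt G₁ t U N + 2 * |t| * k := by
  have h := ThermodynamicLimit.groundEnergyAt_le_add_of_cut G₁ (⊥ : SimpleGraph (Fin 0)) G
    (e₁ := fun x => x) (e₂ := fun i => Fin.elim0 i) (fun _ _ h => h) (fun a => Fin.elim0 a)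
    (fun _ y => Fin.elim0 y) (fun z => Or.inl ⟨z, rfl⟩) (k₁ := k) (k₂ := 0) hk (by simp) t U
    (N₁ := N) (N₂ := 0) hN (Nat.zero_le _)
  have h0 := groundEnergyAt_bot_fin_zero_le t U
  simp only [Nat.cast_zero, add_zero] at h
  linarith

/-- Finite infima of two termwise `D`-close families are `D`-close. [folklore] -/
theorem abs_ciInf_sub_ciInf_le {ι : Type*} [Fintype ι] [Nonempty ι] {f g : ι → ℝ} {D : ℝ}
    (h : ∀ i, |f i - g i| ≤ D) : |(⨅ i, f i) - ⨅ i, g i| ≤ D := by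
  have key : ∀ {u v : ι → ℝ}, (∀ i, |u i - v i| ≤ D) → (⨅ i, v i) ≤ (⨅ i, u i) + D := by
    intro u v huv
    rw [← sub_le_iff_le_add]
    refine le_ciInf fun i => ?_
    have h1 : (⨅ i, v i) ≤ v i := ciInf_le (Finite.bddBelow_range v) i
    have h2 := abs_le.1 (huv i)
    linarith
  have hfg := key h
  have hgf := key (u := g) (v := f) fun i => by rw [abs_sub_comm]; exact h i
  rw [abs_le]
  constructor <;> linarith

/-! ### Torus bonds versus box bonds on `FermionTorus 2 L` -/

/-- Adjacency on the two-dimensional fermionic torus `(ℤ/Lℤ)²` in terms of representatives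
`0 ≤ xᵢ, yᵢ < L`. [folklore] -/
theorem fermionTorusGraph_two_adj_iff {L : ℕ} (x y : FermionTorus 2 L) :
    (fermionTorusGraph 2 L).Adj x y ↔
      ((ofLex x 0 : ℕ) ≠ ofLex y 0 ∨ (ofLex x 1 : ℕ) ≠ ofLex y 1) ∧
      ((((ofLex x 0 : ℕ) + 1) % L = ofLex y 0 ∧ (ofLex x 1 : ℕ) = ofLex y 1) ∨
       ((ofLex x 0 : ℕ) = ofLex y 0 ∧ ((ofLex x 1 : ℕ) + 1) % L = ofLex y 1) ∨
       (((ofLex y 0 : ℕ) + 1) % L = ofLex x 0 ∧ (ofLex y 1 : ℕ) = ofLex x 1) ∨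
       ((ofLex y 0 : ℕ) = ofLex x 0 ∧ ((ofLex y 1 : ℕ) + 1) % L = ofLex x 1)) := by
  have cast_eq : ∀ m n : Fin L, ((m : ℕ) : ZMod L) = ((n : ℕ) : ZMod L) ↔ (m : ℕ) = n := fun m n => by
    rw [ZMod.natCast_eq_natCast_iff', Nat.mod_eq_of_lt m.isLt, Nat.mod_eq_of_lt n.isLt]
  have cast_succ : ∀ m n : Fin L, ((n : ℕ) : ZMod L) = ((m : ℕ) : ZMod L) + 1 ↔ ((m : ℕ) + 1) % L = n :=
    fun m n => by
      rw [eq_comm, ← Nat.cast_succ, ZMod.natCast_eq_natCast_iff', Nat.mod_eq_of_lt n.isLt]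
  have key : ∀ u v : FermionTorus 2 L,
      (∃ i, FermionTorus.toTorusSite v = FermionTorus.toTorusSite u + Pi.single i 1) ↔
        ((((ofLex u 0 : ℕ) + 1) % L = ofLex v 0 ∧ (ofLex u 1 : ℕ) = ofLex v 1) ∨
         ((ofLex u 0 : ℕ) = ofLex v 0 ∧ ((ofLex u 1 : ℕ) + 1) % L = ofLex v 1)) := by
    intro u v
    rw [Fin.exists_fin_two, funext_iff, funext_iff, Fin.forall_fin_two, Fin.forall_fin_two]
    simp only [Pi.add_apply, FermionTorus.toTorusSite_apply, Pi.single_eq_same,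
      Pi.single_eq_of_ne (one_ne_zero (α := Fin 2)), Pi.single_eq_of_ne (zero_ne_one (α := Fin 2)),
      add_zero, cast_eq, cast_succ]
    rw [eq_comm (a := (ofLex v 1 : ℕ)), eq_comm (a := (ofLex v 0 : ℕ))]
  have hne : FermionTorus.toTorusSite x ≠ FermionTorus.toTorusSite y ↔
      ((ofLex x 0 : ℕ) ≠ ofLex y 0 ∨ (ofLex x 1 : ℕ) ≠ ofLex y 1) := by
    rw [Ne, funext_iff, Fin.forall_fin_two, FermionTorus.toTorusSite_apply,
      FermionTorus.toTorusSite_apply, FermionTorus.toTorusSite_apply,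
      FermionTorus.toTorusSite_apply, cast_eq, cast_eq, not_and_or]
  rw [fermionTorusGraph_adj, torusGraph_adj_iff, hne, key, key, or_assoc]

/-- Adjacency on the free-boundary box graph (pull-back of `ℤ²` along the coordinate map) in terms
of the coordinates. [folklore] -/
theorem boxGraph_two_adj_iff {L : ℕ} (x y : FermionTorus 2 L) :
    ((zdGraph 2).comap (fun x : FermionTorus 2 L => fun i : Fin 2 => ((ofLex x i : ℕ) : ℤ))).Adj x y ↔
      (((ofLex x 0 : ℕ) + 1 = ofLex y 0 ∧ (ofLex x 1 : ℕ) = ofLex y 1) ∨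
       ((ofLex x 0 : ℕ) = ofLex y 0 ∧ (ofLex x 1 : ℕ) + 1 = ofLex y 1) ∨
       ((ofLex y 0 : ℕ) + 1 = ofLex x 0 ∧ (ofLex y 1 : ℕ) = ofLex x 1) ∨
       ((ofLex y 0 : ℕ) = ofLex x 0 ∧ (ofLex y 1 : ℕ) + 1 = ofLex x 1)) := by
  rw [SimpleGraph.comap_adj, zdGraph_adj_iff, Fin.exists_fin_two]
  simp only [funext_iff, Fin.forall_fin_two, Pi.add_apply, Pi.single_eq_same,
    Pi.single_eq_of_ne (one_ne_zero (α := Fin 2)), Pi.single_eq_of_ne (zero_ne_one (α := Fin 2)),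
    add_zero]
  constructor
  · rintro ((⟨h1, h2⟩ | ⟨h1, h2⟩) | (⟨h1, h2⟩ | ⟨h1, h2⟩)) <;> omega
  · rintro (⟨h1, h2⟩ | ⟨h1, h2⟩ | ⟨h1, h2⟩ | ⟨h1, h2⟩) <;> omega

/-- **Box bonds are torus bonds.** [folklore] -/
theorem fermionTorusGraph_adj_of_boxGraph_adj {L : ℕ} {x y : FermionTorus 2 L}
    (h : ((zdGraph 2).comap (fun x : FermionTorus 2 L => fun i : Fin 2 => ((ofLex x i : ℕ) : ℤ))).Adj x y) :
    (fermionTorusGraph 2 L).Adj x y := by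
  rw [boxGraph_two_adj_iff] at h
  rw [fermionTorusGraph_two_adj_iff]
  have ha := (ofLex x 0).isLt
  have hb := (ofLex x 1).isLt
  have hc := (ofLex y 0).isLt
  have hd := (ofLex y 1).isLt
  rcases h with ⟨h1, h2⟩ | ⟨h1, h2⟩ | ⟨h1, h2⟩ | ⟨h1, h2⟩
  · refine ⟨Or.inl (by omega), Or.inl ⟨?_, h2⟩⟩
    rwa [Nat.mod_eq_of_lt (by omega)]
  · refine ⟨Or.inr (by omega), Or.inr (Or.inl ⟨h1, ?_⟩)⟩
    rwa [Nat.mod_eq_of_lt (by omega)]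
  · refine ⟨Or.inl (by omega), Or.inr (Or.inr (Or.inl ⟨?_, h2⟩))⟩
    rwa [Nat.mod_eq_of_lt (by omega)]
  · refine ⟨Or.inr (by omega), Or.inr (Or.inr (Or.inr ⟨h1, ?_⟩))⟩
    rwa [Nat.mod_eq_of_lt (by omega)]

/-- **The torus bonds that are not box bonds wrap around a seam**: in one coordinate the values are
`L - 1` and `0` (in some order), in the other they agree. [folklore] -/
theorem wrap_of_fermionTorusGraph_adj {L : ℕ} {x y : FermionTorus 2 L}
    (hT : (fermionTorusGraph 2 L).Adj x y)
    (hB : ¬ ((zdGraph 2).comap (fun x : FermionTorus 2 L => fun i : Fin 2 => ((ofLex x i : ℕ) : ℤ))).Adj x y) :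
    ((ofLex x 0 : ℕ) + 1 = L ∧ (ofLex y 0 : ℕ) = 0 ∧ (ofLex x 1 : ℕ) = ofLex y 1) ∨
    ((ofLex x 0 : ℕ) = 0 ∧ (ofLex y 0 : ℕ) + 1 = L ∧ (ofLex x 1 : ℕ) = ofLex y 1) ∨
    ((ofLex x 1 : ℕ) + 1 = L ∧ (ofLex y 1 : ℕ) = 0 ∧ (ofLex x 0 : ℕ) = ofLex y 0) ∨
    ((ofLex x 1 : ℕ) = 0 ∧ (ofLex y 1 : ℕ) + 1 = L ∧ (ofLex x 0 : ℕ) = ofLex y 0) := by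
  rw [boxGraph_two_adj_iff] at hB
  rw [fermionTorusGraph_two_adj_iff] at hT
  have hmod : ∀ m : ℕ, m < L →
      ((m + 1 < L ∧ (m + 1) % L = m + 1) ∨ (m + 1 = L ∧ (m + 1) % L = 0)) := by
    intro m hm
    rcases Nat.lt_or_ge (m + 1) L with h1 | h1
    · exact Or.inl ⟨h1, Nat.mod_eq_of_lt h1⟩
    · have h2 : m + 1 = L := by omega
      exact Or.inr ⟨h2, by rw [h2, Nat.mod_self]⟩
  obtain ⟨-, ⟨h1, h2⟩ | ⟨h1, h2⟩ | ⟨h1, h2⟩ | ⟨h1, h2⟩⟩ := hT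
  · rcases hmod _ (ofLex x 0).isLt with ⟨h3, h4⟩ | ⟨h3, h4⟩ <;> rw [h4] at h1
    · exact absurd (Or.inl ⟨h1, h2⟩) hB
    · exact Or.inl ⟨h3, h1.symm, h2⟩
  · rcases hmod _ (ofLex x 1).isLt with ⟨h3, h4⟩ | ⟨h3, h4⟩ <;> rw [h4] at h2
    · exact absurd (Or.inr (Or.inl ⟨h1, h2⟩)) hB
    · exact Or.inr (Or.inr (Or.inl ⟨h3, h2.symm, h1⟩))
  · rcases hmod _ (ofLex y 0).isLt with ⟨h3, h4⟩ | ⟨h3, h4⟩ <;> rw [h4] at h1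
    · exact absurd (Or.inr (Or.inr (Or.inl ⟨h1, h2⟩))) hB
    · exact Or.inr (Or.inl ⟨h1.symm, h3, h2.symm⟩)
  · rcases hmod _ (ofLex y 1).isLt with ⟨h3, h4⟩ | ⟨h3, h4⟩ <;> rw [h4] at h2
    · exact absurd (Or.inr (Or.inr (Or.inr ⟨h1, h2⟩))) hB
    · exact Or.inr (Or.inr (Or.inr ⟨h2.symm, h3, h1.symm⟩))

/-- If the torus and the box adjacency of an ordered pair disagree, the pair wraps around a seam.
[folklore] -/
theorem wrap_of_not_adj_iff {L : ℕ} {x y : FermionTorus 2 L}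
    (h : ¬ ((fermionTorusGraph 2 L).Adj x y ↔
      ((zdGraph 2).comap (fun x : FermionTorus 2 L => fun i : Fin 2 => ((ofLex x i : ℕ) : ℤ))).Adj x y)) :
    ((ofLex x 0 : ℕ) + 1 = L ∧ (ofLex y 0 : ℕ) = 0 ∧ (ofLex x 1 : ℕ) = ofLex y 1) ∨
    ((ofLex x 0 : ℕ) = 0 ∧ (ofLex y 0 : ℕ) + 1 = L ∧ (ofLex x 1 : ℕ) = ofLex y 1) ∨
    ((ofLex x 1 : ℕ) + 1 = L ∧ (ofLex y 1 : ℕ) = 0 ∧ (ofLex x 0 : ℕ) = ofLex y 0) ∨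
    ((ofLex x 1 : ℕ) = 0 ∧ (ofLex y 1 : ℕ) + 1 = L ∧ (ofLex x 0 : ℕ) = ofLex y 0) := by
  by_cases hB :
      ((zdGraph 2).comap (fun x : FermionTorus 2 L => fun i : Fin 2 => ((ofLex x i : ℕ) : ℤ))).Adj x y
  · exact absurd (iff_of_true (fermionTorusGraph_adj_of_boxGraph_adj hB) hB) h
  · exact wrap_of_fermionTorusGraph_adj (not_not.1 fun hT => hB ((not_iff.1 h).1 hT)) hB

/-- **At most `4L` ordered pairs of torus sites have different torus and box adjacency** (the
wrap-around bonds: `2` seams, `2` orientations, `L` positions along the seam); stated for any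
decidable sub-predicate `P` of the mismatch predicate, to serve both orders of comparison.
[folklore] -/
theorem card_filter_le_of_not_adj_iff {L : ℕ} (P : FermionTorus 2 L × FermionTorus 2 L → Prop)
    [DecidablePred P]
    (hP : ∀ p, P p → ¬ ((fermionTorusGraph 2 L).Adj p.1 p.2 ↔
      ((zdGraph 2).comap (fun x : FermionTorus 2 L => fun i : Fin 2 => ((ofLex x i : ℕ) : ℤ))).Adj p.1 p.2)) :
    Finset.card {p : FermionTorus 2 L × FermionTorus 2 L | P p} ≤ 4 * L := by
  -- coordinates `(x₀, x₁, y₀, y₁)` of a pair, an injective map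
  set f : FermionTorus 2 L × FermionTorus 2 L → ℕ × ℕ × ℕ × ℕ :=
    fun p => ((ofLex p.1 0 : ℕ), (ofLex p.1 1 : ℕ), (ofLex p.2 0 : ℕ), (ofLex p.2 1 : ℕ)) with hf
  -- the wrap-around coordinate patterns
  set S : Finset (ℕ × ℕ × ℕ × ℕ) :=
    (Finset.range L).image (fun m => (L - 1, m, 0, m)) ∪ (Finset.range L).image (fun m => (0, m, L - 1, m)) ∪
      (Finset.range L).image (fun m => (m, L - 1, m, 0)) ∪ (Finset.range L).image (fun m => (m, 0, m, L - 1))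
    with hS
  have hS4 : S.card ≤ 4 * L := by
    have h1 := Finset.card_image_le (s := Finset.range L) (f := fun m => (L - 1, m, 0, m))
    have h2 := Finset.card_image_le (s := Finset.range L) (f := fun m => (0, m, L - 1, m))
    have h3 := Finset.card_image_le (s := Finset.range L) (f := fun m => (m, L - 1, m, 0))
    have h4 := Finset.card_image_le (s := Finset.range L) (f := fun m => (m, 0, m, L - 1))
    rw [Finset.card_range] at h1 h2 h3 h4
    calc S.card ≤ _ := Finset.card_union_le _ _
      _ ≤ _ := Nat.add_le_add_right (Finset.card_union_le _ _) _
      _ ≤ _ := Nat.add_le_add_right (Nat.add_le_add_right (Finset.card_union_le _ _) _) _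
      _ ≤ L + L + L + L := by gcongr
      _ = 4 * L := by ring
  refine le_trans (Finset.card_le_card_of_injOn f ?_ ?_) hS4
  · intro p hp
    rw [Finset.mem_coe, Finset.mem_filter] at hp
    have hw := wrap_of_not_adj_iff (hP p hp.2)
    have ha := (ofLex p.1 0).isLt
    have hb := (ofLex p.1 1).isLt
    have hc := (ofLex p.2 0).isLt
    have hd := (ofLex p.2 1).isLt
    simp only [hS, Finset.coe_union, Set.mem_union, Finset.coe_image, Set.mem_image, Finset.mem_coe,
      Finset.mem_range, hf, Prod.mk.injEq]
    rcases hw with ⟨h1, h2, h3⟩ | ⟨h1, h2, h3⟩ | ⟨h1, h2, h3⟩ | ⟨h1, h2, h3⟩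
    · exact Or.inl (Or.inl (Or.inl ⟨ofLex p.1 1, hb, by omega, rfl, h2.symm, h3⟩))
    · exact Or.inl (Or.inl (Or.inr ⟨ofLex p.1 1, hb, h1.symm, rfl, by omega, h3⟩))
    · exact Or.inl (Or.inr ⟨ofLex p.1 0, ha, rfl, by omega, h3, h2.symm⟩)
    · exact Or.inr ⟨ofLex p.1 0, ha, rfl, h1.symm, h3, by omega⟩
  · intro p _ q _ h
    simp only [hf, Prod.mk.injEq] at h
    obtain ⟨h1, h2, h3, h4⟩ := h
    refine Prod.ext (ofLex.injective (funext fun i => ?_)) (ofLex.injective (funext fun i => ?_))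
    · fin_cases i
      · exact Fin.ext h1
      · exact Fin.ext h2
    · fin_cases i
      · exact Fin.ext h3
      · exact Fin.ext h4

/-! ### The stub -/

/-- **Torus versus box** (stub `stub_torusBoxComparison` of the line `lro-seed-kink-bridge`). Granted
that the grand-canonical ground energy is the minimum over particle numbers of the sector energies
(the hypothesis, stub `stub_gcGroundEnergyEqMin`), the periodic and the free-boundary grand-canonical
ground energies on the common vertex set `FermionTorus 2 L` differ by at most `8(L+1)`: the two
adjacencies differ on `≤ 4L` ordered wrap-around pairs, each costing `≤ 2|t| = 2` per sector
(`groundEnergyAt_le_add_of_cut` with an empty second block, both directions), and finite minima of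
termwise close families are close. Ruelle, *Statistical Mechanics* (1969) §2. [folklore] -/
theorem stub_torusBoxComparison :
    (∀ {Λ : Type} [LinearOrder Λ] [Fintype Λ] (G : SimpleGraph Λ) [DecidableRel G.Adj] (t U μ : ℝ),
      (hamiltonianWith G t U μ).groundEnergy =
        ⨅ N : Fin (2 * Fintype.card Λ + 1), (groundEnergyAt G t U (N : ℕ) - μ * ((N : ℕ) : ℝ))) →
    ∀ U μ : ℝ, ∃ C : ℝ, ∀ L : ℕ, |(hubbardTorusWith 2 L 1 U μ).groundEnergy - (hamiltonianWith ((zdGraph 2).comap (fun x : FermionTorus 2 L => fun i : Fin 2 => ((ofLex x i : ℕ) : ℤ))) 1 U μ).groundEnergy| ≤ C * ((L : ℝ) + 1) := by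
  intro hGC U μ
  refine ⟨8, fun L => ?_⟩
  -- sector by sector: `|E_T(N) - E_B(N)| ≤ 8L`
  have hsec : ∀ N : ℕ, N ≤ 2 * Fintype.card (FermionTorus 2 L) →
      |groundEnergyAt (fermionTorusGraph 2 L) 1 U N -
        groundEnergyAt ((zdGraph 2).comap (fun x : FermionTorus 2 L => fun i : Fin 2 => ((ofLex x i : ℕ) : ℤ)))
          1 U N| ≤ 8 * L := by
    intro N hN
    have h1 := groundEnergyAt_le_add_of_adj_mismatch (fermionTorusGraph 2 L)
      ((zdGraph 2).comap (fun x : FermionTorus 2 L => fun i : Fin 2 => ((ofLex x i : ℕ) : ℤ)))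
      (card_filter_le_of_not_adj_iff _ fun p hp => hp) 1 U hN
    have h2 := groundEnergyAt_le_add_of_adj_mismatch
      ((zdGraph 2).comap (fun x : FermionTorus 2 L => fun i : Fin 2 => ((ofLex x i : ℕ) : ℤ)))
      (fermionTorusGraph 2 L) (card_filter_le_of_not_adj_iff _ fun p hp h => hp h.symm) 1 U hN
    rw [abs_one, Nat.cast_mul, Nat.cast_ofNat] at h1 h2
    rw [abs_le]
    constructor <;> linarith
  -- the grand-canonical energies are minima over the sectors
  have hT : (hubbardTorusWith 2 L 1 U μ).groundEnergy =
      ⨅ N : Fin (2 * Fintype.card (FermionTorus 2 L) + 1),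
        (groundEnergyAt (fermionTorusGraph 2 L) 1 U (N : ℕ) - μ * ((N : ℕ) : ℝ)) := by
    -- `convert`, not `exact`: the `DecidableEq` instance found on the concrete torus differs
    -- syntactically from the generic `LinearOrder.toDecidableEq` carried by the hypothesis
    unfold hubbardTorusWith
    convert hGC (fermionTorusGraph 2 L) 1 U μ using 2
  have hB : (hamiltonianWith ((zdGraph 2).comap
      (fun x : FermionTorus 2 L => fun i : Fin 2 => ((ofLex x i : ℕ) : ℤ))) 1 U μ).groundEnergy =
      ⨅ N : Fin (2 * Fintype.card (FermionTorus 2 L) + 1),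
        (groundEnergyAt ((zdGraph 2).comap (fun x : FermionTorus 2 L => fun i : Fin 2 => ((ofLex x i : ℕ) : ℤ)))
          1 U (N : ℕ) - μ * ((N : ℕ) : ℝ)) := by
    convert hGC ((zdGraph 2).comap (fun x : FermionTorus 2 L => fun i : Fin 2 => ((ofLex x i : ℕ) : ℤ))) 1 U μ
      using 2
  rw [hT, hB]
  refine (abs_ciInf_sub_ciInf_le (D := 8 * (L : ℝ)) fun N => ?_).trans (by linarith)
  rw [sub_sub_sub_cancel_right]
  exact hsec N (Nat.lt_succ_iff.1 N.isLt)

end Summit.HubbardSuperconductivity.HubbardSuperconductivity.Theorems
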